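import Summits.CriticalPhenomena.CardyFormulaZ2.Theorems.CardyFlipRussoVoronoiHubFromSmirnovDefs
import Literature.Probability.LatticeModels.DelaunayGraph

/-!
# Graph-crossing vocabulary of line `moebius-exact-delaunay-dilation-ward` (crux `VoronoiHubFromSmirnov`,
# stmt-CriticalPhenomena-6433, route `CardyFlipRusso`) — second definitions module (lead c3)

The transport heart S3b (`Sig.stub_transportHeart`, Defs module) compares, for the SAME nuclei, the
continuum crossing of `closure Ω` in the Euclidean Voronoi colouring with the crossing in the
colouring by the tessellation pulled back by the conformal map `h`.  Benjamini–Schramm (1998) prove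
their Thm 2.1 for a CLUSTER event — a chain of adjacent open tiles between nuclei lying in fixed
open sets — precisely because nucleus positions are metric-free while cell boundaries move to
first order under a change of metric ("we feel that it is better to leave the boundary issues to
future investigations", p. 78).  This module provides that vocabulary for the skeleton's re-cut of
S3b (lead c3, 2026-08-17):

* `graphCross K A₀ A₂ δ` — a chain of BLACK nuclei, physically inside `K`, consecutive ones
  Delaunay-adjacent with respect to ALL nuclei, attached by `δ p₀ ∈ A₀`, `δ p_N ∈ A₂`;
  `hGraphCross K A₀ A₂ h V δ` — the same chains with adjacency of the transported images
  (`transportMap`, `transportSet` of the Defs module);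
* `IsDomainFamily R K`, `IsAttachment R i A` — admissible `δ`-dependent carrier / attachment sets:
  measurable and sandwiched between the `a√δ`- and `b√δ`-neighbourhoods of `closure Ω` / of the arc
  `R.arc i` (a collar of vanishing width, so that on the no-void event every cell met by a continuum
  crossing contributes an admissible nucleus, and so that conformal images of admissible families
  are admissible families of the image rectangle);
* the three stub STATEMENTS of the re-cut: `Sig.stub_graphTransport` (S3b-i, BS98 Thm 2.1 proper in
  graph form), `Sig.stub_graphVsContinuum` (S3b-ii, the Jordan boundary layer — the RSW content),
  `Sig.stub_graphLaw` (S3b-iii, the exact law identity for graph events: Kingman mapping +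
  restriction + Rényi, as in the landed S3a), and the two brick statements `Sig.stub_graphRestrict`
  (locality of the homogeneous graph event) and `Sig.stub_attachmentImage` (transport of admissible
  families); the skeleton glues `Sig.stub_transportHeart` from these five and the landed S3a.

Only the elementary identities for the homogeneous profile `ρ ≡ 1` are asserted (and proved).

Sources: I. Benjamini, O. Schramm, Comm. Math. Phys. 197 (1998) 75–107, §2 (the event `C`), Thm 2.1,
§9; B. Bollobás, O. Riordan, *Percolation* (CUP 2006), Ch. 8 §8.2 (Delaunay-graph formulation of
Voronoi percolation); V. Tassion, Ann. Probab. 44 (2016) (RSW for Voronoi percolation).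
-/

noncomputable section

namespace Summit.CriticalPhenomena.CardyFormulaZ2.Cruxes.VoronoiHubFromSmirnov.MoebiusExactDelaunayDilationWard

open scoped Topology ENNReal
open Filter Set MeasureTheory
open Literature.Analysis.FunctionSpaces
open Literature.Probability.RandomPlanarGeometry
open Literature.Probability.LatticeModels (IsDelaunayPair)

/-! ### Graph crossing events -/

/-- **Graph crossing event** (Benjamini–Schramm's cluster event `C`, re-cut; configuration
coordinates, physical positions `δ p`): a chain of BLACK nuclei `p₀, …, p_N` of `c.1` with
`δ pᵢ ∈ K`, consecutive ones Delaunay-adjacent (`IsDelaunayPair`: a closed disc with both on its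
boundary and no nucleus of either colour inside) with respect to ALL nuclei `c.1 ∪ c.2`, and
`δ p₀ ∈ A₀`, `δ p_N ∈ A₂`. -/
def graphCross (K A₀ A₂ : Set ℂ) (δ : ℝ) : Set (PointConfig ℂ × PointConfig ℂ) :=
  {c | ∃ (N : ℕ) (p : Fin (N + 1) → ℂ), (∀ i, p i ∈ c.1) ∧ (∀ i, (δ : ℂ) * p i ∈ K) ∧
    (δ : ℂ) * p 0 ∈ A₀ ∧ (δ : ℂ) * p (Fin.last N) ∈ A₂ ∧
    ∀ i : Fin N, IsDelaunayPair ((c.1 : Set ℂ) ∪ (c.2 : Set ℂ)) (p i.castSucc) (p i.succ)}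

/-- **Pulled-back graph crossing event**: the same chains and attachments, but adjacency of the
IMAGES `transportMap h δ pᵢ = h (δ pᵢ)/δ` with respect to the transported nuclei of both colours
(window `V`, `transportSet`) — i.e. Delaunay adjacency for the tessellation pulled back by `h`. -/
def hGraphCross (K A₀ A₂ : Set ℂ) (h : ℂ → ℂ) (V : Set ℂ) (δ : ℝ) :
    Set (PointConfig ℂ × PointConfig ℂ) :=
  {c | ∃ (N : ℕ) (p : Fin (N + 1) → ℂ), (∀ i, p i ∈ c.1) ∧ (∀ i, (δ : ℂ) * p i ∈ K) ∧
    (δ : ℂ) * p 0 ∈ A₀ ∧ (δ : ℂ) * p (Fin.last N) ∈ A₂ ∧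
    ∀ i : Fin N, IsDelaunayPair (transportSet h V δ c.1 ∪ transportSet h V δ c.2)
      (transportMap h δ (p i.castSucc)) (transportMap h δ (p i.succ))}

/-! ### Admissible carrier and attachment families -/

/-- **Admissible domain (carrier) families**: measurable sets `K δ` carrying the chain nuclei,
sandwiched, eventually as `δ → 0⁺`, between the `a√δ`- and the `b√δ`-neighbourhoods of `closure Ω`
(`0 < a ≤ b`): a collar of vanishing width `≍ √δ ≫` cell size around the closed domain. -/
def IsDomainFamily (R : ConformalRectangle) (K : ℝ → Set ℂ) : Prop :=
  ∃ a b : ℝ, 0 < a ∧ a ≤ b ∧ ∀ᶠ δ : ℝ in 𝓝[>] 0, MeasurableSet (K δ) ∧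
    Metric.thickening (a * Real.sqrt δ) (closure R.carrier) ⊆ K δ ∧
    K δ ⊆ Metric.thickening (b * Real.sqrt δ) (closure R.carrier)

/-- **Admissible attachment families** for the arc `R.arc i`: measurable sets `A δ` sandwiched,
eventually as `δ → 0⁺`, between the `a√δ`- and the `b√δ`-neighbourhoods of the arc (`0 < a ≤ b`).
The standard family is `δ ↦ thickening √δ (R.arc i)`. -/
def IsAttachment (R : ConformalRectangle) (i : Fin 4) (A : ℝ → Set ℂ) : Prop :=
  ∃ a b : ℝ, 0 < a ∧ a ≤ b ∧ ∀ᶠ δ : ℝ in 𝓝[>] 0, MeasurableSet (A δ) ∧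
    Metric.thickening (a * Real.sqrt δ) (R.arc i) ⊆ A δ ∧
    A δ ⊆ Metric.thickening (b * Real.sqrt δ) (R.arc i)

/-! ### Stub statements of the S3b re-cut (lead c3, 2026-08-17) -/

/-- S3b-i — GRAPH TRANSPORT (Benjamini–Schramm 1998 Thm 2.1 PROPER, planar case, graph form): in
the setting of S3b (`h` univalent on `U ⊇ closure V`, `V ⊇ closure Ω` bounded open, admissible
`ρ = ‖h′‖²` on `V`), for every admissible carrier family and attachment families, the Euclidean and
the pulled-back graph crossing events of the SAME inhomogeneous nuclei have probabilities differing
by `o(1)` as `δ → 0⁺`.  Content: on the no-giant-cells event the two adjacency relations agree near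
`closure Ω` except at local potential defects (BS98 Lemma 4.2, landed `defect_implies_potentialDefect`;
Möbius-exactness of empty circumdiscs), `O(polylog δ⁻¹)` of them in expectation (Prop. 5.3; landed
`poisson_navelTie_le`, `poisson_closePair_le`), to whose recolouring the fair colouring is insensitive
(§§7–9: Lemma 8.1 = landed `insensitivity_unionLaw`; clean configurations, FKG for Poisson).
OPEN in tree. (source: BenjaminiSchramm1998, Thm 2.1 and §9) -/
def Sig.stub_graphTransport : Prop :=
  ∀ (R : ConformalRectangle) (h : ℂ → ℂ) (U : Set ℂ), IsOpen U →
    closure R.carrier ⊆ U → DifferentiableOn ℂ h U → InjOn h U →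
    ∀ V : Set ℂ, IsOpen V → Bornology.IsBounded V → closure R.carrier ⊆ V → closure V ⊆ U →
    ∀ ρ, AdmissibleDensity ρ → (∀ z ∈ V, ρ z = ‖deriv h z‖ ^ 2) →
    ∀ (K A₀ A₂ : ℝ → Set ℂ), IsDomainFamily R K → IsAttachment R 0 A₀ → IsAttachment R 2 A₂ →
      Tendsto (fun δ => (lawBW (intensity ρ 1 δ)).real (graphCross (K δ) (A₀ δ) (A₂ δ) δ)
        - (lawBW (intensity ρ 1 δ)).real (hGraphCross (K δ) (A₀ δ) (A₂ δ) h V δ)) (𝓝[>] 0) (𝓝 0)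

/-- S3b-ii — GRAPH vs CONTINUUM (the Jordan boundary layer; the RSW content of the line): for every
admissible profile (`ρ ≡ 1` is the homogeneous model), every conformal rectangle and every
admissible carrier / attachment families, the continuum crossing probability `crossProb ρ 1 R δ` and
the probability of the graph crossing event differ by `o(1)` as `δ → 0⁺`.  One inclusion is
deterministic on the no-void event (a black continuum path in `closure Ω` passes through a chain of
small black cells whose nuclei lie in the `√δ`-collar: landed `blackPath_cellChain`,
`isDelaunayPair_iff_voronoiCell`, `poisson_noVoid_tendsto`); the other — black chains in the collar
that cannot be realised by a path inside `closure Ω`, or that stop `≤ b√δ` short of the arcs — is a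
boundary three-arm / one-arm estimate between the scales `δ√log δ⁻¹` and `√δ` (Tassion 2016 RSW,
to be adapted to admissible inhomogeneous intensities). OPEN in tree. (source: Tassion2016, Thm 1; BollobasRiordan2006, Ch. 8) -/
def Sig.stub_graphVsContinuum : Prop :=
  ∀ ρ, AdmissibleDensity ρ → ∀ (R : ConformalRectangle) (K A₀ A₂ : ℝ → Set ℂ),
    IsDomainFamily R K → IsAttachment R 0 A₀ → IsAttachment R 2 A₂ →
      Tendsto (fun δ => crossProb ρ 1 R δ
        - (lawBW (intensity ρ 1 δ)).real (graphCross (K δ) (A₀ δ) (A₂ δ) δ)) (𝓝[>] 0) (𝓝 0)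

/-- S3b-iii — GRAPH LAW IDENTITY (Kingman Mapping + Restriction Theorems and Rényi uniqueness, as
in the landed S3a `stub_transportCoupling`): at every mesh `δ > 0`, for measurable `A₀, A₂ ⊆ K ⊆ V`,
the probability of the pulled-back graph event under the inhomogeneous model `ρ` EQUALS the
probability, under the homogeneous law read on the nuclei in the window `h(V)/δ`, of the Euclidean
graph event with the image data `h '' K`, `h '' A₀`, `h '' A₂` (the pulled-back event is the preimage
of the image event under transport of both colours, `map_transport_poissonLaw`; needs measurability
of `graphCross`). Provable now. (source: Kingman1993, §2.3 Mapping Theorem) -/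
def Sig.stub_graphLaw : Prop :=
  ∀ (R : ConformalRectangle) (h : ℂ → ℂ) (U : Set ℂ), IsOpen U →
    closure R.carrier ⊆ U → DifferentiableOn ℂ h U → InjOn h U →
    ∀ V : Set ℂ, IsOpen V → Bornology.IsBounded V → closure R.carrier ⊆ V → closure V ⊆ U →
    ∀ ρ, AdmissibleDensity ρ → (∀ z ∈ V, ρ z = ‖deriv h z‖ ^ 2) →
    ∀ (K A₀ A₂ : Set ℂ) (δ : ℝ), 0 < δ → MeasurableSet K → MeasurableSet A₀ → MeasurableSet A₂ →
      K ⊆ V → A₀ ⊆ K → A₂ ⊆ K →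
      (lawBW (intensity ρ 1 δ)).real (hGraphCross K A₀ A₂ h V δ) =
        (lawBW (volume : Measure ℂ)).real
          {c | (PointConfig.restrict {b : ℂ | (δ : ℂ) * b ∈ h '' V} c.1,
            PointConfig.restrict {b : ℂ | (δ : ℂ) * b ∈ h '' V} c.2) ∈
            graphCross (h '' K) (h '' A₀) (h '' A₂) δ}

/-- Brick — LOCALITY OF THE HOMOGENEOUS GRAPH EVENT: for carrier families inside a fixed compact
`K' ⊆ W` (open), reading the graph crossing event on the nuclei of the window `W/δ` only changes its
probability by `o(1)` (empty circumdiscs through nuclei deep inside the window are small on the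
no-void event, so Delaunay adjacency there ignores far nuclei; cf. the landed
`homCrossProb_restrict_tendsto` for the continuum event). Provable now. (folklore) -/
def Sig.stub_graphRestrict : Prop :=
  ∀ (K' W : Set ℂ), IsCompact K' → IsOpen W → K' ⊆ W → ∀ (K B₀ B₂ : ℝ → Set ℂ), (∀ δ, K δ ⊆ K') →
    Tendsto (fun δ : ℝ => (lawBW (volume : Measure ℂ)).real
        {c | (PointConfig.restrict {b : ℂ | (δ : ℂ) * b ∈ W} c.1,
          PointConfig.restrict {b : ℂ | (δ : ℂ) * b ∈ W} c.2) ∈ graphCross (K δ) (B₀ δ) (B₂ δ) δ}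
      - (lawBW (volume : Measure ℂ)).real (graphCross (K δ) (B₀ δ) (B₂ δ) δ)) (𝓝[>] 0) (𝓝 0)

/-- Brick — TRANSPORT OF ADMISSIBLE FAMILIES: conformal images of attachment / carrier families of
`R` are attachment / carrier families of the image rectangle `h • R` (`h` is bi-Lipschitz near
`closure Ω`: landed `holo_uniform_bounds`; measurability of the images by Lusin–Souslin). Provable
now. (folklore) -/
def Sig.stub_attachmentImage : Prop :=
  ∀ (R : ConformalRectangle) (h : ℂ → ℂ) (U : Set ℂ) (hU : IsOpen U)
    (hRU : closure R.carrier ⊆ U) (hd : DifferentiableOn ℂ h U) (hi : InjOn h U),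
    (∀ (i : Fin 4) (A : ℝ → Set ℂ), IsAttachment R i A →
      IsAttachment (R.imageUnivalent h (hd.mono hRU) (hi.mono hRU)) i fun δ => h '' A δ) ∧
    (∀ K : ℝ → Set ℂ, IsDomainFamily R K →
      IsDomainFamily (R.imageUnivalent h (hd.mono hRU) (hi.mono hRU)) fun δ => h '' K δ)

/-! ### Elementary glue: the homogeneous model is the admissible profile `ρ ≡ 1` -/

/-- The constant profile `1` is admissible. -/
theorem admissibleDensity_one : AdmissibleDensity fun _ : ℂ => (1 : ℝ) := by
  refine ⟨contDiff_const, ?_, fun _ => one_pos⟩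
  simp only [sub_self]
  exact HasCompactSupport.zero

/-- For `ρ ≡ 1` every path intensity is Lebesgue measure (registered glue sub-goal). -/
theorem intensity_const_one : ∀ (t δ : ℝ), intensity (fun _ : ℂ => (1 : ℝ)) t δ = MeasureTheory.volume := by
  intro t δ
  unfold intensity densityPath
  simp only [sub_self, mul_zero, add_zero, ENNReal.ofReal_one]
  exact withDensity_one

/-- Hence its crossing probabilities are the homogeneous ones. -/
theorem crossProb_const_one (R : ConformalRectangle) (t δ : ℝ) :
    crossProb (fun _ : ℂ => (1 : ℝ)) t R δ = homCrossProb R δ := by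
  unfold crossProb homCrossProb
  rw [intensity_const_one]

end Summit.CriticalPhenomena.CardyFormulaZ2.Cruxes.VoronoiHubFromSmirnov.MoebiusExactDelaunayDilationWard

end
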